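import Mathlib
import Summits.Ventures.PercRepro2.Defs
import Summits.Ventures.PercRepro2.Independence
import Summits.Ventures.PercRepro2.Harris
import Summits.Ventures.PercRepro2.Graph
import Summits.Ventures.PercRepro2.Events
import Summits.Ventures.PercRepro2.GateCylinder
import Summits.Ventures.PercRepro2.CCTRootEdge
import Summits.Ventures.PercRepro2.CDNestedStep
import Summits.Ventures.PercRepro2.CDNestedRouteChain

/-!
# Internal edges of a joined set, and the first-index partition (blind cell PercRepro2, mine-a g35;
MINE-A.md §90, proofs/MINEA-CD-NESTED.md §1 «KEY OBSERVATION»)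

Under a forced vector `p[B ↦ 1]` with `S` JOINED by `B` (every configuration with the edges of `B` open
connects every vertex of `S` to `a₁`), an edge with both endpoints in `S` is INTERNAL: opening it changes
no connection.  For events `X` determined by the connections (`Q`, `Q ∩ U`, `Q ∩ f`, …) this gives

* `prob_forceOpen_eq_piecewise` — `P_{p[F ↦ 1]}(X) = P_p({ω ∣ ω[F ↦ open] ∈ X})`, the many-edge form of
  `CCT.prob_update_one_eq` (`ω[F ↦ open] = F.piecewise (fun _ => true) ω`);
* `conn_piecewise_iff` — opening internal edges keeps every connection;
* `prob_forceOpen_union_internal` — `P_{p[F ∪ B ↦ 1]}(X) = P_{p[B ↦ 1]}(X)` for `F` internal to `S`;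
* `prob_forceOpen_inter_internal` — under `p[B ↦ 1]`, `X` is independent of every event determined by
  the internal edges `F`: `P(X ∩ Y) = P(X) · P(Y)`;
* `prob_inter_biUnion_eq_sum` — the first-index partition of a union,
  `P(X ∩ ⋃_{i<k} A_i) = ∑_{i<k} P(X ∩ A_i ∩ ⋂_{l<i} A_lᶜ)`;
* the `foldl` bookkeeping of routes (`subset_foldl_insert`, `snd_mem_foldl_insert`,
  `fst_mem_foldl_of_walk`, `mem_foldl_insert_edges`, `foldl_insert_edges_eq_union`).

These are the pieces of the route decomposition of the nested-routes theorem
(`CDNestedRoutes.cd_of_nested_routes`).  No definition; one seat.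
-/

namespace Summit.Ventures.PercRepro2

namespace CDNestedInternal

section Piecewise

variable {E : Type*} [DecidableEq E]

/-- `ω[F ↦ open]` lies in the cylinder of `F`. -/
lemma piecewise_mem_cylinder (F : Finset E) (ω : Config E) :
    F.piecewise (fun _ => true) ω ∈ GateCylinder.cylinder F := by
  intro e he
  simp [Finset.piecewise_eq_of_mem _ _ _ he]

/-- `ω ≤ ω[F ↦ open]`. -/
lemma le_piecewise (F : Finset E) (ω : Config E) : ω ≤ F.piecewise (fun _ => true) ω := by
  intro e
  by_cases he : e ∈ F
  · simp [Finset.piecewise_eq_of_mem _ _ _ he]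
  · simp [Finset.piecewise_eq_of_notMem _ _ _ he]

/-- `ω[F ∪ B ↦ open] = (ω[B ↦ open])[F ↦ open]`. -/
lemma piecewise_union (F B : Finset E) (ω : Config E) :
    (F ∪ B).piecewise (fun _ => true) ω =
      F.piecewise (fun _ => true) (B.piecewise (fun _ => true) ω) := by
  funext e
  by_cases hF : e ∈ F
  · simp [Finset.piecewise_eq_of_mem, hF]
  · by_cases hB : e ∈ B
    · simp [Finset.piecewise_eq_of_mem, Finset.piecewise_eq_of_notMem, hF, hB]
    · simp [Finset.piecewise_eq_of_notMem, hF, hB]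

variable [Fintype E] {R : Type*} [Field R] [LinearOrder R] [IsStrictOrderedRing R]

omit [LinearOrder R] [IsStrictOrderedRing R] in
/-- **Forcing a set of edges open is opening them in the configuration**:
`P_{p[F ↦ 1]}(X) = P_p({ω ∣ ω[F ↦ open] ∈ X})` (the many-edge `CCT.prob_update_one_eq`). -/
theorem prob_forceOpen_eq_piecewise (p : E → R) (F : Finset E) (X : Set (Config E)) :
    prob (GateCylinder.forceOpen p F) X = prob p {ω | F.piecewise (fun _ => true) ω ∈ X} := by
  induction F using Finset.induction_on generalizing X with
  | empty =>
    rw [show GateCylinder.forceOpen p ∅ = p from funext fun e => by simp [GateCylinder.forceOpen]]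
    simp
  | insert e F _ ih =>
    rw [CDNestedStep.forceOpen_insert, CCT.prob_update_one_eq, ih]
    congr 1
    ext ω
    simp only [Set.mem_setOf_eq, Finset.piecewise_insert]

end Piecewise

section Conn

variable {V : Type*} {E : Type*} [DecidableEq E]

/-- **Opening internal edges keeps every connection**: if `S` is joined by `B`, every edge of `F` has
both endpoints in `S`, and `ω` has `B` open, then `ω[F ↦ open]` has the same connections as `ω`. -/
lemma conn_piecewise_iff {ends : E → Sym2 V} {B F : Finset E} {a₁ : V} {S : Finset V}
    (hJ : ∀ ω : Config E, ω ∈ GateCylinder.cylinder B → ∀ v ∈ S, Conn ends ω a₁ v)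
    (hF : ∀ f ∈ F, ∃ x ∈ S, ∃ y ∈ S, ends f = s(x, y))
    {ω : Config E} (hω : ω ∈ GateCylinder.cylinder B) (u w : V) :
    Conn ends (F.piecewise (fun _ => true) ω) u w ↔ Conn ends ω u w := by
  constructor
  · intro h
    refine mem_of_conn_of_closed (ends := ends) (ω := F.piecewise (fun _ => true) ω)
      (S := {y | Conn ends ω u y}) ?_ (conn_refl _ _ _) h
    intro x hx y hxy
    obtain ⟨_, e, he, hends⟩ := openGraph_adj.1 hxy
    simp only [Set.mem_setOf_eq] at hx ⊢
    by_cases heF : e ∈ F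
    · obtain ⟨x', hx', y', hy', hends'⟩ := hF e heF
      have h1 := hJ ω hω x' hx'
      have h2 := hJ ω hω y' hy'
      rw [hends, Sym2.eq_iff] at hends'
      rcases hends' with ⟨rfl, rfl⟩ | ⟨rfl, rfl⟩
      · exact conn_trans hx (conn_trans (conn_symm h1) h2)
      · exact conn_trans hx (conn_trans (conn_symm h2) h1)
    · have he' : ω e = true := by
        rw [Finset.piecewise_eq_of_notMem _ _ _ heF] at he
        exact he
      exact conn_trans hx (conn_of_openAdj ⟨e, he', hends⟩)
  · exact conn_mono (le_piecewise F ω)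

/-- Membership in a connectivity-determined event survives opening internal edges. -/
lemma mem_piecewise_iff {ends : E → Sym2 V} {B F : Finset E} {a₁ : V} {S : Finset V}
    (hJ : ∀ ω : Config E, ω ∈ GateCylinder.cylinder B → ∀ v ∈ S, Conn ends ω a₁ v)
    (hF : ∀ f ∈ F, ∃ x ∈ S, ∃ y ∈ S, ends f = s(x, y)) {X : Set (Config E)}
    (hX : ∀ ω ω' : Config E, (∀ u w, Conn ends ω u w ↔ Conn ends ω' u w) → (ω ∈ X ↔ ω' ∈ X))
    {ω : Config E} (hω : ω ∈ GateCylinder.cylinder B) :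
    F.piecewise (fun _ => true) ω ∈ X ↔ ω ∈ X :=
  hX _ _ (conn_piecewise_iff hJ hF hω)

variable [Fintype E] {R : Type*} [Field R] [LinearOrder R] [IsStrictOrderedRing R]

omit [LinearOrder R] [IsStrictOrderedRing R] in
/-- **Internal edges do not change a connectivity-determined mass**:
`P_{p[F ∪ B ↦ 1]}(X) = P_{p[B ↦ 1]}(X)` when every edge of `F` has both endpoints in a set joined by `B`. -/
theorem prob_forceOpen_union_internal (p : E → R) {ends : E → Sym2 V} {B F : Finset E} {a₁ : V}
    {S : Finset V} (hJ : ∀ ω : Config E, ω ∈ GateCylinder.cylinder B → ∀ v ∈ S, Conn ends ω a₁ v)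
    (hF : ∀ f ∈ F, ∃ x ∈ S, ∃ y ∈ S, ends f = s(x, y)) (X : Set (Config E))
    (hX : ∀ ω ω' : Config E, (∀ u w, Conn ends ω u w ↔ Conn ends ω' u w) → (ω ∈ X ↔ ω' ∈ X)) :
    prob (GateCylinder.forceOpen p (F ∪ B)) X = prob (GateCylinder.forceOpen p B) X := by
  rw [prob_forceOpen_eq_piecewise, prob_forceOpen_eq_piecewise]
  congr 1
  ext ω
  simp only [Set.mem_setOf_eq]
  rw [piecewise_union]
  exact mem_piecewise_iff hJ hF hX (piecewise_mem_cylinder B ω)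

omit [LinearOrder R] [IsStrictOrderedRing R] in
/-- **Independence from the internal edges**: under `p[B ↦ 1]`, a connectivity-determined event `X` is
independent of every event `Y` determined by a set `F` of edges internal to a set joined by `B`. -/
theorem prob_forceOpen_inter_internal (p : E → R) {ends : E → Sym2 V} {B F : Finset E} {a₁ : V}
    {S : Finset V} (hJ : ∀ ω : Config E, ω ∈ GateCylinder.cylinder B → ∀ v ∈ S, Conn ends ω a₁ v)
    (hF : ∀ f ∈ F, ∃ x ∈ S, ∃ y ∈ S, ends f = s(x, y)) (X Y : Set (Config E))
    (hX : ∀ ω ω' : Config E, (∀ u w, Conn ends ω u w ↔ Conn ends ω' u w) → (ω ∈ X ↔ ω' ∈ X))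
    (hY : DependsOn (· ∈ Y) (↑F : Set E)) :
    prob (GateCylinder.forceOpen p B) (X ∩ Y) =
      prob (GateCylinder.forceOpen p B) X * prob (GateCylinder.forceOpen p B) Y := by
  rw [prob_forceOpen_eq_piecewise, prob_forceOpen_eq_piecewise, prob_forceOpen_eq_piecewise]
  have hX' : {ω : Config E | B.piecewise (fun _ => true) ω ∈ X} =
      {ω | (F ∪ B).piecewise (fun _ => true) ω ∈ X} := by
    ext ω
    simp only [Set.mem_setOf_eq]
    rw [piecewise_union]
    exact (mem_piecewise_iff hJ hF hX (piecewise_mem_cylinder B ω)).symm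
  have hsplit : {ω : Config E | B.piecewise (fun _ => true) ω ∈ X ∩ Y} =
      {ω | B.piecewise (fun _ => true) ω ∈ X} ∩ {ω | B.piecewise (fun _ => true) ω ∈ Y} := by
    ext ω
    simp only [Set.mem_inter_iff, Set.mem_setOf_eq]
  rw [hsplit, hX']
  refine prob_inter_eq_mul_of_dependsOn p (F₁ := (↑(F ∪ B) : Set E)ᶜ) (F₂ := (↑F : Set E)) ?_ ?_ ?_
  · rw [Set.disjoint_left]
    intro e he heF
    exact he (by simp [Finset.mem_coe.1 heF])
  · intro ω ω' h
    have hpw : (F ∪ B).piecewise (fun _ => true) ω = (F ∪ B).piecewise (fun _ => true) ω' := by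
      funext e
      by_cases he : e ∈ F ∪ B
      · simp [Finset.piecewise_eq_of_mem, he]
      · rw [Finset.piecewise_eq_of_notMem _ _ _ he, Finset.piecewise_eq_of_notMem _ _ _ he]
        exact h e (by simpa using he)
    show ((F ∪ B).piecewise (fun _ => true) ω ∈ X) = ((F ∪ B).piecewise (fun _ => true) ω' ∈ X)
    rw [hpw]
  · intro ω ω' h
    have hF' : ∀ e ∈ (↑F : Set E),
        B.piecewise (fun _ => true) ω e = B.piecewise (fun _ => true) ω' e := by
      intro e he
      by_cases hB : e ∈ B
      · simp [Finset.piecewise_eq_of_mem, hB]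
      · rw [Finset.piecewise_eq_of_notMem _ _ _ hB, Finset.piecewise_eq_of_notMem _ _ _ hB]
        exact h e he
    exact propext (dependsOn_mem_iff hY hF')

end Conn

section Partition

variable {E : Type*} [Fintype E] [DecidableEq E] {R : Type*} [CommRing R]

/-- **The first-index partition of a union**:
`P(X ∩ ⋃_{i<k} A_i) = ∑_{i<k} P(X ∩ A_i ∩ ⋂_{l<i} A_lᶜ)`. -/
theorem prob_inter_biUnion_eq_sum (p : E → R) (X : Set (Config E)) (A : ℕ → Set (Config E)) :
    ∀ k : ℕ, prob p (X ∩ ⋃ i ∈ Finset.range k, A i) =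
      ∑ i ∈ Finset.range k, prob p (X ∩ A i ∩ ⋂ l ∈ Finset.range i, (A l)ᶜ) := by
  intro k
  induction k with
  | zero => simp
  | succ k ih =>
    have hsplit : X ∩ ⋃ i ∈ Finset.range (k + 1), A i =
        (X ∩ ⋃ i ∈ Finset.range k, A i) ∪ (X ∩ A k ∩ ⋂ l ∈ Finset.range k, (A l)ᶜ) := by
      ext ω
      simp only [Set.mem_inter_iff, Set.mem_union, Set.mem_iUnion, Set.mem_iInter,
        Set.mem_compl_iff, Finset.mem_range, exists_prop]
      constructor
      · rintro ⟨hX, i, hi, hA⟩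
        by_cases hl : ∃ l, l < k ∧ ω ∈ A l
        · exact Or.inl ⟨hX, hl⟩
        · push Not at hl
          have hik : i = k := by
            by_contra hne
            exact hl i (by omega) hA
          subst hik
          exact Or.inr ⟨⟨hX, hA⟩, hl⟩
      · rintro (⟨hX, i, hi, hA⟩ | ⟨⟨hX, hA⟩, _⟩)
        · exact ⟨hX, i, by omega, hA⟩
        · exact ⟨hX, k, by omega, hA⟩
    have hdisj : Disjoint (X ∩ ⋃ i ∈ Finset.range k, A i)
        (X ∩ A k ∩ ⋂ l ∈ Finset.range k, (A l)ᶜ) := by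
      rw [Set.disjoint_left]
      rintro ω ⟨_, hU⟩ ⟨_, hI⟩
      simp only [Set.mem_iUnion, Finset.mem_range, exists_prop] at hU
      simp only [Set.mem_iInter, Set.mem_compl_iff, Finset.mem_range] at hI
      obtain ⟨l, hl, hA⟩ := hU
      exact hI l hl hA
    rw [Finset.sum_range_succ, ← ih, hsplit, prob_union_of_disjoint p hdisj]

end Partition

section Routes

variable {V : Type*} {E : Type*} [DecidableEq E] [DecidableEq V]

omit [DecidableEq E] in
/-- The vertex set of a route contains its starting set. -/
lemma subset_foldl_insert (L : List (E × V × V)) :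
    ∀ S : Finset V, S ⊆ L.foldl (fun acc t => insert t.2.2 acc) S := by
  induction L with
  | nil => intro S; simp
  | cons t L ih =>
    intro S
    simp only [List.foldl_cons]
    exact (Finset.subset_insert _ _).trans (ih _)

omit [DecidableEq E] in
/-- The vertex set of a route contains the second vertex of each of its triples. -/
lemma snd_mem_foldl_insert (L : List (E × V × V)) :
    ∀ (S : Finset V) (t : E × V × V), t ∈ L →
      t.2.2 ∈ L.foldl (fun acc t => insert t.2.2 acc) S := by
  induction L with
  | nil => intro S t ht; simp at ht
  | cons u L ih =>
    intro S t ht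
    simp only [List.foldl_cons]
    rcases List.mem_cons.1 ht with rfl | ht
    · exact subset_foldl_insert L _ (Finset.mem_insert_self _ _)
    · exact ih _ t ht

omit [DecidableEq E] in
/-- The vertex set of a walk-ordered route contains the first vertex of each of its triples. -/
lemma fst_mem_foldl_of_walk {S : Finset V} {L : List (E × V × V)}
    (hwalk : ∀ i (hi : i < L.length), (L.get ⟨i, hi⟩).2.1 ∈
      S ∪ ((L.take i).map (fun u => u.2.2)).toFinset) :
    ∀ t ∈ L, t.2.1 ∈ L.foldl (fun acc t => insert t.2.2 acc) S := by
  intro t ht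
  obtain ⟨n, rfl⟩ := List.mem_iff_get.1 ht
  have h := hwalk n.1 n.2
  rw [Finset.mem_union] at h
  rcases h with hS | hT
  · exact subset_foldl_insert L S hS
  · rw [List.mem_toFinset, List.mem_map] at hT
    obtain ⟨u, hu, hyu⟩ := hT
    rw [← hyu]
    exact snd_mem_foldl_insert L S u (List.mem_of_mem_take hu)

omit [DecidableEq V] in
/-- Membership in the edge set of a route. -/
lemma mem_foldl_insert_edges (L : List (E × V × V)) :
    ∀ (B : Finset E) (b : E),
      b ∈ L.foldl (fun acc t => insert t.1 acc) B ↔ b ∈ B ∨ ∃ t ∈ L, t.1 = b := by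
  induction L with
  | nil => intro B b; simp
  | cons u L ih =>
    intro B b
    simp only [List.foldl_cons, ih, Finset.mem_insert, List.mem_cons]
    constructor
    · rintro ((rfl | hB) | ⟨t, ht, rfl⟩)
      · exact Or.inr ⟨u, Or.inl rfl, rfl⟩
      · exact Or.inl hB
      · exact Or.inr ⟨t, Or.inr ht, rfl⟩
    · rintro (hB | ⟨t, (rfl | ht), rfl⟩)
      · exact Or.inl (Or.inr hB)
      · exact Or.inl (Or.inl rfl)
      · exact Or.inr ⟨t, ht, rfl⟩

omit [DecidableEq V] in
/-- The edge set of a route built on `B` is the edge set built on `∅`, united with `B`. -/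
lemma foldl_insert_edges_eq_union (L : List (E × V × V)) (B : Finset E) :
    L.foldl (fun acc t => insert t.1 acc) B = L.foldl (fun acc t => insert t.1 acc) ∅ ∪ B := by
  ext b
  simp only [mem_foldl_insert_edges, Finset.mem_union, Finset.notMem_empty, false_or]
  exact or_comm

end Routes

end CDNestedInternal

end Summit.Ventures.PercRepro2
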